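import Literature.MathematicalPhysics.QuantumFieldTheory.Balaban1983to89.B12GaugeFixExpansion25Holo
import Literature.MathematicalPhysics.QuantumFieldTheory.Balaban1983to89.B12ChiInvariance269
import Literature.MathematicalPhysics.QuantumFieldTheory.Balaban1983to89.T4TermwiseUN

/-!
# `Balaban1983to89.B12Eq25GaugeInvariance216` — [Balaban1987RG1] p. 269 (2.16) ON THE GAUGE-FIXING LETTERS OF
(2.5) p. 266: the variables `Ṽ′(y, x)`, print's `G(Ṽ′) = G(B′)`, the quadratic part `G⁽²⁾(B′)` and the third-order
part `G₃(B′)` are INVARIANT under the gauge transformations `V⁽ᵏ⁾ → (V⁽ᵏ⁾)^u`, `B′ → R(u)B′` — PROVED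

statement-level skeleton of published theorems with citation tags; proofs where landed; nothing here is a claim about the Yang–Mills mass gap

CITATION HEADER.  T. Bałaban, *Renormalization group approach to lattice gauge field theories. I. Generation of
effective actions in a small field approximation and a coupling constant renormalization in four dimensions*,
Commun. Math. Phys. **109** (1987) 249–301, doi:10.1007/bf01215223 [Balaban1987RG1] (cell paper B12; held text
`paper:balaban1987-cmp109-rg-i-small-field`, journal page = PDF page + 248; pp. 265, 266, 269 [PDF 17, 18, 21] re-read
from the text layer `p0017.txt` / `p0018.txt` / `p0021.txt` for this file).  Unit `lit-balaban-r09` gen 45 (display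
owner of CMP 109; TAKING line `HOME/STATUS.md` 2026-08-23T20:14:03Z), HOME `run/shared/lean/pub/lit-balaban/`;
SKELETON rows `B12.Eq2.5`, `B12.Eq2.16` (cells only) and GAPS entry G-B12-09 (iii) («the invariance under (2.16) of the
gauge-fixing function G of (2.5) … recalled; no row in print beyond the recall»).

WHAT IS PRINTED (verbatim, «…»).
* p. 265 [PDF 17]: *«We introduce new integration variables V′ = V(V⁽ᵏ⁾)⁻¹, or V = V′V⁽ᵏ⁾ […] A gauge
  transformation v of V induces the gauge transformation v of V⁽ᵏ⁾ and the transformation B′ → R(v)B′. The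
  expressions in (2.1) are invariant with respect to these transformations.»*
* p. 266 [PDF 18]: *«The gauge fixing term under the exponential in (2.1) is equal to G(V′V⁽ᵏ⁾) = G(Ṽ′) = G(B′). The
  variables Ṽ′(y, x) = (V′V⁽ᵏ⁾)(y, x) (V⁽ᵏ⁾(y, x))⁻¹ have an expansion of the form Ṽ′(y, x) = 1 + B̃′(y, x) + …,
  where B̃′(y, x) is a linear function, hence the gauge fixing expression has the representation
  G(B′) = Σ_{y∈T⁽ᵏ⁺¹⁾} Σ_{x∈B(y), x≠y} ½|B̃′(y, x)|² + G₃(B′) = ½G⁽²⁾(B′) + G₃(B′). (2.5)»*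
* p. 269 [PDF 21]: *«The gauge invariance was discussed already several times in the previous papers, so let us recall
  only that all the expressions in (2.12), together with the measure, are invariant with respect to the gauge
  transformations U_{k+1} → U^u_{k+1}, B′ → R(u)B′, (R(u)B′)(b) = R(u(b₋))B′(b). (2.16)»* — (2.12) p. 268 carries the
  gauge-fixing letters through the quadratic form `−½⟨B′, Δ⁽ᵏ⁾B′⟩` (p. 267: «the definition (3.156) [13] with the
  δ-function gauge fixing term replaced by the exponential one», i.e. with `½G⁽²⁾`) and the term `−(1/g_k²)G₃(g_kCB)`.

DICTIONARY print → Lean (all PRE-EXISTING, consumed by name, nothing restated).  `Ṽ′(y, x)(B′)` ↦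
`B12GaugeFixExpansion25.tildeV cd Vk pert B' y x` (over `Setup.ContourData.holTo`, `pert B′ = V′V⁽ᵏ⁾`, `pert 0 = V⁽ᵏ⁾`);
`B̃′(y, x)` ↦ `B12GaugeFixExpansion25.Btilde ρ cd Vk pert y x` (Fréchet derivative at `0` in a unitary matrix
realisation `ρ`); `G⁽²⁾`, `G₃,y`, `G₃`, `g₃` ↦ `G2`, `G3block`, `G3`, `rem3` (real reading) and `GC`, `G2C`, `G3Cblock`,
`G3C`, `rem3C`, `gHol` (holomorphic reading, `B12GaugeFixExpansion25Holo`); `V^u` ↦ `Setup.GaugeField.gaugeAct u V`;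
`U(y, x)` covariance ↦ the structure field `Setup.ContourData.covariant`; `Re tr` ↦ `GaugeGroup.reTr` with
`GaugeGroup.reTr_conj`; `(R(u)B′)(b) = R(u(b₋))B′(b)` ↦ `B12ChiInvariance269.rotFluct` (the (2.16) body of record);
`|·|²` ↦ `MatrixNorms.nhsNormSq` with `T4TermwiseUN.nhsNormSq_unitary_conj`.

THE TYPING OF (2.16) ON (2.5).  The (2.5) files keep `B′ ∈ E` (a normed space) and `V′V⁽ᵏ⁾ = pert B′` abstract.  The
transformation (2.16) is therefore the datum of: a gauge transformation `u : GaugeTransf P k G` of `T⁽ᵏ⁾`, a map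
`R : E → E` («B′ → R(u)B′»; a continuous linear equivalence where derivatives are taken), and the perturbation map
`pert′` around the transformed background `(V⁽ᵏ⁾)^u`, tied by the hypothesis
  `hR : ∀ B′, pert′ (R B′) = (pert B′)^u`
— which IS p. 265's sentence «A gauge transformation v of V induces the gauge transformation v of V⁽ᵏ⁾ and the
transformation B′ → R(v)B′» read from right to left (`V = V′V⁽ᵏ⁾ ↦ V^v`).  § 6 DISCHARGES `hR` on print's carrier
`E = VecField P k 𝔤` for every bondwise perturbation `(pert B′)(b) = φ(B′(b))·V⁽ᵏ⁾(b)` with an `Ad`-equivariant chart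
`φ` (`φ(R(g)X) = gφ(X)g⁻¹`, e.g. `φ = exp i·`), `R(u) = rotFluct R u` (`pertOf_rotFluct`); the `ℤᵈ` twin of this
discharge is `B12Average012Covariance.gaugeTransformZd_pert`.

WHAT THIS MODULE PROVES (kernel-checked; no `sorry`; no `Prop` fact; axioms standard).
* § 1 `tildeV_gaugeAct` — **`Ṽ′(y, x) ↦ u(y) Ṽ′(y, x) u(y)⁻¹`** under (2.16) (`ContourData.covariant` twice: the two
  factors `u(x)⁻¹`, `u(x)` at the inner end point cancel); `reTr_tildeV_gaugeAct` — `1 − Re tr Ṽ′(y, x)` is invariant.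
* § 2 `Gtilde` — print's `G(Ṽ′)` as a function of `(V⁽ᵏ⁾, B′)` WITH BODY (`Σ_y Σ_{x∈B(y), x≠y} [1 − Re tr Ṽ′(y, x)(B′)]`);
  `Gtilde_eq_gaugeFixFn` («G(V′V⁽ᵏ⁾) = G(Ṽ′)» for `V⁽ᵏ⁾` in the block axial gauge, the step of `eq25`);
  `Gtilde_eq_half_G2_add_G3` («= ½G⁽²⁾(B′) + G₃(B′)», unconditionally); **`Gtilde_gaugeAct`** — `G(Ṽ′)` is invariant
  under (2.16) for EVERY `u` (no gauge condition, no smallness).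
* § 3 `conjL` / `conjCLE` (`Ad_Q : X ↦ QXQ′` as a real continuous linear map / equivalence of `M_n(ℂ)`);
  **`Btilde_gaugeAct`** — `B̃′_{(V⁽ᵏ⁾)^u}(y, x)(R(u)B′) = ρ(u(y)) B̃′_{V⁽ᵏ⁾}(y, x)(B′) ρ(u(y)⁻¹)` for a continuous linear
  equivalence `R` (unconditional: `fderiv` through linear equivalences); `nhsNormSq_Btilde_gaugeAct`,
  **`G2_gaugeAct`** — `G⁽²⁾` is invariant (unitary `ρ`).
* § 4 `rem3_conj` (one germ), `G3block_gaugeAct`, **`G3_gaugeAct`** — `G₃,y` and `G₃` are invariant (unitary `ρ`).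
* § 5 the holomorphic reading: `gHol_conj`, `rem3C_conj`, **`GC_gaugeAct`**, **`G2C_gaugeAct`**, `G3Cblock_gaugeAct`,
  **`G3C_gaugeAct`** — invariant for ANY matrix realisation `ρ` (no unitarity: trace cyclicity only), i.e. also for
  the `Gᶜ`-valued gauge transformations of (1.19) p. 263 when `G` is the complexified group.
* § 6 `pertOf`, `pertOf_zero`, **`pertOf_rotFluct`** (discharge of `hR` on `VecField P k 𝔤`), `rotFluctL` (`rotFluct`
  for a family of continuous linear equivalences `R(g)`, as a continuous linear equivalence), and the assembled
  statements on print's carrier `Gtilde_rotFluct`, `G2_rotFluct`, `G3_rotFluct`.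

HONEST SCOPE / NOT PROVED HERE.  (a) The invariant object is `G(Ṽ′)` as a function of the PAIR `(V⁽ᵏ⁾, B′)`; its
identification with `G(V′V⁽ᵏ⁾)` is the axial-gauge step `Gtilde_eq_gaugeFixFn` (`eq25`), and a general `u` does not
preserve the block axial gauge of `V⁽ᵏ⁾` (only the block-constant lifts of `B12RTGaugeInvariance254.liftTransf` do) —
exactly as in print, where `V⁽ᵏ⁾ = Ū^k_{k+1}` (2.3) is re-chosen in the axial gauge of the transformed orbit.  (b) The
other letters of (2.12) recalled at (2.16) — `h`, `C̃⁽²⁾`, `D̃` of p. 267 and `V` of (2.8) — are NOT treated here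
(GAPS G-B12-09 (ii), and (iii) for `V`); the measure, `χ_k`, `LQ̃`, the RT integration and `σ` are the tree's
`B12Eq216MeasureCovariance`, `B12ChiInvariance269`, `B12Average012QtildeCovariance`, `B12RTGaugeInvariance254`,
`B13HaarSigmaJacobian`.  (c) Matrices carry the operator norm of [12] (19) (scope `Matrix.Norms.L2Operator`) and, for
the real reading, the restriction-of-scalars real structure of `B12GaugeFixExpansion25` (its two file-local instances
re-activated locally here, so that `Btilde`/`G2`/`rem3` are the SAME terms).  Nothing of the series is asserted.
-/

open Filter Asymptotics open scoped Matrix Matrix.Norms.L2Operator Topology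

namespace Literature.MathematicalPhysics.QuantumFieldTheory.Balaban1983to89.B12Eq25GaugeInvariance216

open Literature.MathematicalPhysics.QuantumFieldTheory.Balaban1983to89 UnitaryModel MatrixNorms
  B12GaugeFixExpansion25 B12GaugeFixExpansion25Holo

noncomputable section

/-! ## 1. (2.16) on the variables `Ṽ′(y, x)` of (2.5) -/

section TildeV

variable {P : Params} {k : ℕ} {G : Type*} [GaugeGroup G] {E : Type*}

/-- **(2.16) on `Ṽ′(y, x)`**: under `V⁽ᵏ⁾ → (V⁽ᵏ⁾)^u`, `B′ → R(u)B′` with `V′V⁽ᵏ⁾ → (V′V⁽ᵏ⁾)^u` (hypothesis `hR`, p. 265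
«A gauge transformation v of V induces the gauge transformation v of V⁽ᵏ⁾ and the transformation B′ → R(v)B′»), the
variables `Ṽ′(y, x) = (V′V⁽ᵏ⁾)(y, x)(V⁽ᵏ⁾(y, x))⁻¹` of p. 266 are conjugated by `u(y)`:
`Ṽ′(y, x) ↦ u(y) Ṽ′(y, x) u(y)⁻¹` — both contour variables transform by `U(y, x) ↦ u(y)U(y, x)u(x)⁻¹`
(`ContourData.covariant`) and the inner factors cancel. [cite: Balaban1987RG1, (2.16) p.269] -/
theorem tildeV_gaugeAct (cd : ContourData P k G) (u : GaugeTransf P k G) (Vk : GaugeField P k G)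
    {pert pert' : E → GaugeField P k G} {R : E → E}
    (hR : ∀ B', pert' (R B') = GaugeField.gaugeAct u (pert B')) (B' : E) (y : Site P (k+1)) (x : Site P k) :
    tildeV cd (GaugeField.gaugeAct u Vk) pert' (R B') y x
      = u (emb y) * tildeV cd Vk pert B' y x * (u (emb y))⁻¹ := by
  rw [tildeV, tildeV, hR, cd.covariant, cd.covariant]
  group

/-- **(2.16) on `1 − Re tr Ṽ′(y, x)`**: the summand of the gauge-fixing function at the variables `Ṽ′(y, x)` is
invariant under (2.16) (`Re tr` is a class function, `GaugeGroup.reTr_conj`). [cite: Balaban1987RG1, (2.16) p.269] -/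
theorem reTr_tildeV_gaugeAct (cd : ContourData P k G) (u : GaugeTransf P k G) (Vk : GaugeField P k G)
    {pert pert' : E → GaugeField P k G} {R : E → E}
    (hR : ∀ B', pert' (R B') = GaugeField.gaugeAct u (pert B')) (B' : E) (y : Site P (k+1)) (x : Site P k) :
    reTr (tildeV cd (GaugeField.gaugeAct u Vk) pert' (R B') y x) = reTr (tildeV cd Vk pert B' y x) := by
  rw [tildeV_gaugeAct cd u Vk hR, GaugeGroup.reTr_conj]

/-! ## 2. Print's `G(Ṽ′) = G(B′)` as a function of `(V⁽ᵏ⁾, B′)`, and its invariance -/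

/-- p. 266 *«G(V′V⁽ᵏ⁾) = G(Ṽ′) = G(B′)»*: the gauge-fixing function `Σ_{y∈Y} Σ_{x∈B(y), x≠y} [1 − Re tr ·]` of
(0.17)/(2.1) EVALUATED AT THE VARIABLES `Ṽ′(y, x)(B′)` of p. 266, as a function of the background `V⁽ᵏ⁾` and of `B′`
(`Y = T⁽ᵏ⁺¹⁾` in print, kept general as in `Setup.gaugeFixFn`). [cite: Balaban1987RG1, (2.5) p.266] -/
def Gtilde (cd : ContourData P k G) (Vk : GaugeField P k G) (pert : E → GaugeField P k G)
    (Y : Finset (Site P (k+1))) (B' : E) : ℝ :=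
  ∑ y ∈ Y, ∑ x ∈ (block y).erase (emb y), (1 - reTr (tildeV cd Vk pert B' y x))

/-- Unfolding of `Gtilde`. [cite: Balaban1987RG1, (2.5) p.266] -/
theorem Gtilde_def (cd : ContourData P k G) (Vk : GaugeField P k G) (pert : E → GaugeField P k G)
    (Y : Finset (Site P (k+1))) (B' : E) :
    Gtilde cd Vk pert Y B' = ∑ y ∈ Y, ∑ x ∈ (block y).erase (emb y), (1 - reTr (tildeV cd Vk pert B' y x)) := rfl

/-- A site of `B(y) ∖ {y}` lies in the block of `y` and is not its centre. [cite: Balaban1987RG1, (0.1) p.252] -/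
private lemma blockOf_of_mem_erase' {y : Site P (k+1)} {x : Site P k} (hx : x ∈ (block y).erase (emb y)) :
    blockOf x = y ∧ x ≠ emb y := by
  rw [Finset.mem_erase, block, Finset.mem_filter] at hx
  exact ⟨hx.2.2, hx.1⟩

/-- p. 266 *«G(V′V⁽ᵏ⁾) = G(Ṽ′)»*: for `V⁽ᵏ⁾` in the block axial gauge (p. 265 «the axial gauge conditions G(V) = 0»;
`Setup.AxialGauge`) the variables `Ṽ′(y, x)` ARE the contour variables of `V′V⁽ᵏ⁾`, so `G(Ṽ′)(B′) = G(V′V⁽ᵏ⁾)`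
(`Setup.gaugeFixFn` at `pert B′`) — the first step of `B12GaugeFixExpansion25.eq25`. [cite: Balaban1987RG1, (2.5) p.266] -/
theorem Gtilde_eq_gaugeFixFn (cd : ContourData P k G) {Vk : GaugeField P k G} (pert : E → GaugeField P k G)
    (hax : AxialGauge cd Vk) (Y : Finset (Site P (k+1))) (B' : E) :
    Gtilde cd Vk pert Y B' = gaugeFixFn cd Y (pert B') := by
  unfold Gtilde gaugeFixFn
  refine Finset.sum_congr rfl fun y _ => Finset.sum_congr rfl fun x hx => ?_
  obtain ⟨hblk, hne⟩ := blockOf_of_mem_erase' hx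
  rw [tildeV, hax y x hblk hne, inv_one, mul_one]

/-- **`G(Ṽ′)` IS GAUGE INVARIANT under (2.16)** — `G(Ṽ′)((V⁽ᵏ⁾)^u, R(u)B′) = G(Ṽ′)(V⁽ᵏ⁾, B′)` for every gauge
transformation `u` (no gauge condition on `V⁽ᵏ⁾`, no smallness of `B′`), termwise by `reTr_tildeV_gaugeAct`.  This is
the (2.16) clause for the exponential gauge-fixing term `G` of (2.1)/(2.12). [cite: Balaban1987RG1, (2.16) p.269] -/
theorem Gtilde_gaugeAct (cd : ContourData P k G) (u : GaugeTransf P k G) (Vk : GaugeField P k G)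
    {pert pert' : E → GaugeField P k G} {R : E → E}
    (hR : ∀ B', pert' (R B') = GaugeField.gaugeAct u (pert B')) (Y : Finset (Site P (k+1))) (B' : E) :
    Gtilde cd (GaugeField.gaugeAct u Vk) pert' Y (R B') = Gtilde cd Vk pert Y B' := by
  unfold Gtilde
  refine Finset.sum_congr rfl fun y _ => Finset.sum_congr rfl fun x _ => ?_
  rw [reTr_tildeV_gaugeAct cd u Vk hR]

end TildeV

section Realisation

variable {n : Type*} [Fintype n] [DecidableEq n] {G : Type*} [GaugeGroup G]

/-- A matrix realisation `ρ` of the group: `ρ(g)ρ(g⁻¹) = 1`. [folklore] -/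
private lemma rho_mul_rho_inv (ρ : G →* Matrix n n ℂ) (g : G) : ρ g * ρ g⁻¹ = 1 := by
  rw [← map_mul, mul_inv_cancel, map_one]

/-- A matrix realisation `ρ` of the group: `ρ(g⁻¹)ρ(g) = 1`. [folklore] -/
private lemma rho_inv_mul_rho (ρ : G →* Matrix n n ℂ) (g : G) : ρ g⁻¹ * ρ g = 1 := by
  rw [← map_mul, inv_mul_cancel, map_one]

/-- For a UNITARY-valued realisation, `ρ(g⁻¹) = ρ(g)*`. [folklore] -/
private lemma rho_inv_eq_star {ρ : G →* Matrix n n ℂ} (hρU : ∀ g : G, ρ g ∈ Matrix.unitaryGroup n ℂ) (g : G) :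
    ρ g⁻¹ = star (ρ g) :=
  (left_inv_eq_right_inv (Matrix.mem_unitaryGroup_iff'.mp (hρU g)) (rho_mul_rho_inv ρ g)).symm

end Realisation

/-! ## 3. The linear parts `B̃′(y, x)` and the quadratic part `G⁽²⁾` under (2.16) (real reading, unitary `ρ`) -/

section Real

variable {n : Type*} [Fintype n] [DecidableEq n]

attribute [local instance 10000] B12GaugeFixExpansion25.instModuleRealMatrixComplex
  B12GaugeFixExpansion25.instNormedSpaceRealMatrixComplex

/-- The conjugation `X ↦ Q X Q′` of `M_n(ℂ)` as a REAL continuous linear map (restriction-of-scalars structure of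
`B12GaugeFixExpansion25`); for `Q′ = Q⁻¹ = ρ(u(y)⁻¹)` this is the adjoint action `R(u(y))` of (2.16) in the matrix
realisation. [cite: Balaban1987RG1, (2.16) p.269] -/
def conjL (Q Q' : Matrix n n ℂ) : Matrix n n ℂ →L[ℝ] Matrix n n ℂ where
  toFun X := Q * X * Q'
  map_add' X Y := by simp only [mul_add, add_mul]
  map_smul' r X := by
    simp only [RingHom.id_apply]
    rw [← Complex.coe_smul, ← Complex.coe_smul, Matrix.mul_smul, Matrix.smul_mul]
  cont := (continuous_const.mul continuous_id).mul continuous_const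

/-- Unfolding of `conjL`. [cite: Balaban1987RG1, (2.16) p.269] -/
@[simp] theorem conjL_apply (Q Q' X : Matrix n n ℂ) : conjL Q Q' X = Q * X * Q' := rfl

/-- The adjoint action `X ↦ Q X Q′`, `QQ′ = Q′Q = 1`, as a real continuous linear EQUIVALENCE of `M_n(ℂ)` (inverse
`X ↦ Q′ X Q`). [cite: Balaban1987RG1, (2.16) p.269] -/
def conjCLE (Q Q' : Matrix n n ℂ) (h1 : Q * Q' = 1) (h2 : Q' * Q = 1) : Matrix n n ℂ ≃L[ℝ] Matrix n n ℂ :=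
  ContinuousLinearEquiv.equivOfInverse (conjL Q Q') (conjL Q' Q)
    (fun X => by
      simp only [conjL_apply, ← mul_assoc]
      rw [h2, one_mul, mul_assoc, h2, mul_one])
    (fun X => by
      simp only [conjL_apply, ← mul_assoc]
      rw [h1, one_mul, mul_assoc, h1, mul_one])

/-- Unfolding of `conjCLE`. [cite: Balaban1987RG1, (2.16) p.269] -/
@[simp] theorem conjCLE_apply (Q Q' : Matrix n n ℂ) (h1 : Q * Q' = 1) (h2 : Q' * Q = 1) (X : Matrix n n ℂ) :
    conjCLE Q Q' h1 h2 X = Q * X * Q' := rfl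

variable {P : Params} {k : ℕ} {G : Type*} [GaugeGroup G]
variable {E : Type*} [NormedAddCommGroup E] [NormedSpace ℝ E]

/-- **(2.16) on the linear parts `B̃′(y, x)`** (p. 266 «Ṽ′(y, x) = 1 + B̃′(y, x) + …»): when `B′ → R(u)B′` is a
continuous linear equivalence `R` of `E`, the Fréchet derivatives at `0` of the transformed and the original variables
are conjugate — `B̃′_{(V⁽ᵏ⁾)^u}(y, x)(RB′) = ρ(u(y)) · B̃′_{V⁽ᵏ⁾}(y, x)(B′) · ρ(u(y)⁻¹)`.  Unconditional (no
differentiability assumed): `ρ ∘ Ṽ′_{(V⁽ᵏ⁾)^u}(y, x) = Ad_{ρ(u(y))} ∘ (ρ ∘ Ṽ′_{V⁽ᵏ⁾}(y, x)) ∘ R⁻¹` and `fderiv`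
passes through continuous linear equivalences on both sides. [cite: Balaban1987RG1, (2.16) p.269] -/
theorem Btilde_gaugeAct (ρ : G →* Matrix n n ℂ) (cd : ContourData P k G) (u : GaugeTransf P k G)
    (Vk : GaugeField P k G) {pert pert' : E → GaugeField P k G} (R : E ≃L[ℝ] E)
    (hR : ∀ B', pert' (R B') = GaugeField.gaugeAct u (pert B')) (y : Site P (k+1)) (x : Site P k) (B' : E) :
    Btilde ρ cd (GaugeField.gaugeAct u Vk) pert' y x (R B')
      = ρ (u (emb y)) * Btilde ρ cd Vk pert y x B' * ρ (u (emb y))⁻¹ := by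
  set Φ := conjCLE (ρ (u (emb y))) (ρ (u (emb y))⁻¹) (rho_mul_rho_inv ρ _) (rho_inv_mul_rho ρ _) with hΦ
  have hfun : (fun B'' => ρ (tildeV cd (GaugeField.gaugeAct u Vk) pert' B'' y x))
      = Φ ∘ ((fun B'' => ρ (tildeV cd Vk pert B'' y x)) ∘ R.symm) := by
    funext C
    have h := tildeV_gaugeAct cd u Vk hR (R.symm C) y x
    rw [R.apply_symm_apply] at h
    simp only [Function.comp_apply, hΦ, conjCLE_apply, h, map_mul]
  unfold Btilde
  rw [hfun, Φ.comp_fderiv, R.symm.comp_right_fderiv, map_zero]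
  simp only [ContinuousLinearMap.coe_comp, Function.comp_apply, ContinuousLinearEquiv.coe_coe,
    ContinuousLinearEquiv.symm_apply_apply, hΦ, conjCLE_apply]

/-- **(2.16) on `|B̃′(y, x)|²`**: for a UNITARY matrix realisation `ρ` the `L²` norms of the linear parts are
invariant (`|QXQ*|² = |X|²`). [cite: Balaban1987RG1, (2.16) p.269] -/
theorem nhsNormSq_Btilde_gaugeAct {ρ : G →* Matrix n n ℂ} (hρU : ∀ g : G, ρ g ∈ Matrix.unitaryGroup n ℂ)
    (cd : ContourData P k G) (u : GaugeTransf P k G) (Vk : GaugeField P k G)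
    {pert pert' : E → GaugeField P k G} (R : E ≃L[ℝ] E)
    (hR : ∀ B', pert' (R B') = GaugeField.gaugeAct u (pert B')) (y : Site P (k+1)) (x : Site P k) (B' : E) :
    nhsNormSq (Btilde ρ cd (GaugeField.gaugeAct u Vk) pert' y x (R B')) = nhsNormSq (Btilde ρ cd Vk pert y x B') := by
  rw [Btilde_gaugeAct ρ cd u Vk R hR, rho_inv_eq_star hρU]
  exact T4TermwiseUN.nhsNormSq_unitary_conj (Matrix.mem_unitaryGroup_iff'.mp (hρU _)) _

/-- **(2.16) on the quadratic part `G⁽²⁾(B′) = Σ_y Σ_{x∈B(y), x≠y} |B̃′(y, x)B′|²` of (2.5)**: invariant under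
`V⁽ᵏ⁾ → (V⁽ᵏ⁾)^u`, `B′ → R(u)B′` for a unitary matrix realisation `ρ` and a continuous linear equivalence `R` — the
(2.16) clause for the gauge-fixing part of the quadratic form `−½⟨B′, Δ⁽ᵏ⁾B′⟩` of (2.11)/(2.12).
[cite: Balaban1987RG1, (2.16) p.269] -/
theorem G2_gaugeAct {ρ : G →* Matrix n n ℂ} (hρU : ∀ g : G, ρ g ∈ Matrix.unitaryGroup n ℂ)
    (cd : ContourData P k G) (u : GaugeTransf P k G) (Vk : GaugeField P k G)
    {pert pert' : E → GaugeField P k G} (R : E ≃L[ℝ] E)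
    (hR : ∀ B', pert' (R B') = GaugeField.gaugeAct u (pert B')) (Y : Finset (Site P (k+1))) (B' : E) :
    G2 ρ cd (GaugeField.gaugeAct u Vk) pert' Y (R B') = G2 ρ cd Vk pert Y B' := by
  unfold G2
  refine Finset.sum_congr rfl fun y _ => Finset.sum_congr rfl fun x _ => ?_
  exact nhsNormSq_Btilde_gaugeAct hρU cd u Vk R hR y x B'

/-! ## 4. The third-order part `G₃` under (2.16) (real reading, unitary `ρ`) -/

/-- ONE GERM: if two germs `W`, `W′ : E → M_n(ℂ)` are related by `W′(Rx) = Q W(x) Q*` with `Q` unitary and `R` a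
continuous linear equivalence, their third-order remainders `g₃` of (2.5) agree: `g₃[W′](Rx) = g₃[W](x)`
(`Re tr` cyclic, `UnitaryModel.nReTr_conj`; `DW′(0) = Ad_Q ∘ DW(0) ∘ R⁻¹`; `|·|²` unitarily invariant,
`T4TermwiseUN.nhsNormSq_unitary_conj`). [cite: Balaban1987RG1, (2.5) p.266] -/
theorem rem3_conj {W W' : E → Matrix n n ℂ} {Q : Matrix n n ℂ} (hQ : Q ∈ Matrix.unitaryGroup n ℂ)
    (R : E ≃L[ℝ] E) (hW : ∀ x, W' (R x) = Q * W x * star Q) (x : E) :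
    rem3 W' (R x) = rem3 W x := by
  have h2 : star Q * Q = 1 := Matrix.mem_unitaryGroup_iff'.mp hQ
  have h1 : Q * star Q = 1 := Matrix.mem_unitaryGroup_iff.mp hQ
  set Φ := conjCLE Q (star Q) h1 h2 with hΦ
  have hfun : W' = Φ ∘ (W ∘ R.symm) := by
    funext C
    have h := hW (R.symm C)
    rw [R.apply_symm_apply] at h
    simp only [Function.comp_apply, hΦ, conjCLE_apply, h]
  have hD : fderiv ℝ W' 0 (R x) = Q * fderiv ℝ W 0 x * star Q := by
    rw [hfun, Φ.comp_fderiv, R.symm.comp_right_fderiv, map_zero]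
    simp only [ContinuousLinearMap.coe_comp, Function.comp_apply, ContinuousLinearEquiv.coe_coe,
      ContinuousLinearEquiv.symm_apply_apply, hΦ, conjCLE_apply]
  rw [rem3, rem3, hD, hW, nReTr_conj h2, T4TermwiseUN.nhsNormSq_unitary_conj h2]

/-- **(2.16) on the block term `G₃,y(B′)`** of (2.5) («localized in blocks»): invariant under `V⁽ᵏ⁾ → (V⁽ᵏ⁾)^u`,
`B′ → R(u)B′` (unitary `ρ`, `R` a continuous linear equivalence), block by block. [cite: Balaban1987RG1, (2.16) p.269] -/
theorem G3block_gaugeAct {ρ : G →* Matrix n n ℂ} (hρU : ∀ g : G, ρ g ∈ Matrix.unitaryGroup n ℂ)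
    (cd : ContourData P k G) (u : GaugeTransf P k G) (Vk : GaugeField P k G)
    {pert pert' : E → GaugeField P k G} (R : E ≃L[ℝ] E)
    (hR : ∀ B', pert' (R B') = GaugeField.gaugeAct u (pert B')) (y : Site P (k+1)) (B' : E) :
    G3block ρ cd (GaugeField.gaugeAct u Vk) pert' y (R B') = G3block ρ cd Vk pert y B' := by
  unfold G3block
  refine Finset.sum_congr rfl fun x _ => ?_
  refine rem3_conj (hρU (u (emb y))) R (fun C => ?_) B'
  rw [tildeV_gaugeAct cd u Vk hR C y x, map_mul, map_mul, rho_inv_eq_star hρU]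

/-- **(2.16) on the third-order part `G₃(B′) = Σ_y G₃,y(B′)`** of (2.5) — the letter `G₃(g_kCB)` of (2.12):
invariant under `V⁽ᵏ⁾ → (V⁽ᵏ⁾)^u`, `B′ → R(u)B′` (unitary `ρ`, `R` a continuous linear equivalence).
[cite: Balaban1987RG1, (2.16) p.269] -/
theorem G3_gaugeAct {ρ : G →* Matrix n n ℂ} (hρU : ∀ g : G, ρ g ∈ Matrix.unitaryGroup n ℂ)
    (cd : ContourData P k G) (u : GaugeTransf P k G) (Vk : GaugeField P k G)
    {pert pert' : E → GaugeField P k G} (R : E ≃L[ℝ] E)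
    (hR : ∀ B', pert' (R B') = GaugeField.gaugeAct u (pert B')) (Y : Finset (Site P (k+1))) (B' : E) :
    G3 ρ cd (GaugeField.gaugeAct u Vk) pert' Y (R B') = G3 ρ cd Vk pert Y B' := by
  unfold G3
  exact Finset.sum_congr rfl fun y _ => G3block_gaugeAct hρU cd u Vk R hR y B'

/-- **(2.5) AT THE INVARIANT OBJECT**: `G(Ṽ′)(V⁽ᵏ⁾, B′) = ½G⁽²⁾(B′) + G₃(B′)` in a unitary matrix realisation `ρ` of
`Re tr`, WITHOUT the axial gauge condition on `V⁽ᵏ⁾` (the identity `1 − Re tr W = ½|DW(0)B′|² + g₃` is the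
definition of `g₃ = rem3`); with `Gtilde_eq_gaugeFixFn` this is `eq25`. [cite: Balaban1987RG1, (2.5) p.266] -/
theorem Gtilde_eq_half_G2_add_G3 (ρ : G →* Matrix n n ℂ) (hρtr : ∀ g : G, reTr g = nReTr (ρ g))
    (cd : ContourData P k G) (Vk : GaugeField P k G) (pert : E → GaugeField P k G)
    (Y : Finset (Site P (k+1))) (B' : E) :
    Gtilde cd Vk pert Y B' = (1 / 2) * G2 ρ cd Vk pert Y B' + G3 ρ cd Vk pert Y B' := by
  unfold Gtilde G2 G3 G3block rem3 Btilde
  beta_reduce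
  rw [Finset.mul_sum, ← Finset.sum_add_distrib]
  refine Finset.sum_congr rfl fun y _ => ?_
  rw [Finset.mul_sum, ← Finset.sum_add_distrib]
  refine Finset.sum_congr rfl fun x _ => ?_
  rw [hρtr]
  ring

end Real

/-! ## 5. The holomorphic reading (`B12GaugeFixExpansion25Holo`) under (2.16): ANY matrix realisation `ρ` -/

section Holo

variable {n : Type*} [Fintype n] [DecidableEq n]

/-- The conjugation `X ↦ Q X Q′` as a COMPLEX continuous linear map of `M_n(ℂ)`. [cite: Balaban1987RG1, (2.16) p.269] -/
def conjLC (Q Q' : Matrix n n ℂ) : Matrix n n ℂ →L[ℂ] Matrix n n ℂ where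
  toFun X := Q * X * Q'
  map_add' X Y := by simp only [mul_add, add_mul]
  map_smul' r X := by
    simp only [RingHom.id_apply]
    rw [Matrix.mul_smul, Matrix.smul_mul]
  cont := (continuous_const.mul continuous_id).mul continuous_const

/-- Unfolding of `conjLC`. [cite: Balaban1987RG1, (2.16) p.269] -/
@[simp] theorem conjLC_apply (Q Q' X : Matrix n n ℂ) : conjLC Q Q' X = Q * X * Q' := rfl

/-- The adjoint action `X ↦ Q X Q′`, `QQ′ = Q′Q = 1`, as a complex continuous linear equivalence of `M_n(ℂ)`.
[cite: Balaban1987RG1, (2.16) p.269] -/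
def conjCLEC (Q Q' : Matrix n n ℂ) (h1 : Q * Q' = 1) (h2 : Q' * Q = 1) : Matrix n n ℂ ≃L[ℂ] Matrix n n ℂ :=
  ContinuousLinearEquiv.equivOfInverse (conjLC Q Q') (conjLC Q' Q)
    (fun X => by
      simp only [conjLC_apply, ← mul_assoc]
      rw [h2, one_mul, mul_assoc, h2, mul_one])
    (fun X => by
      simp only [conjLC_apply, ← mul_assoc]
      rw [h1, one_mul, mul_assoc, h1, mul_one])

/-- Unfolding of `conjCLEC`. [cite: Balaban1987RG1, (2.16) p.269] -/
@[simp] theorem conjCLEC_apply (Q Q' : Matrix n n ℂ) (h1 : Q * Q' = 1) (h2 : Q' * Q = 1) (X : Matrix n n ℂ) :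
    conjCLEC Q Q' h1 h2 X = Q * X * Q' := rfl

/-- `tr (QXQ′) = tr X` for `Q′Q = 1`. [folklore] -/
private lemma ntr_conj {Q Q' : Matrix n n ℂ} (h2 : Q' * Q = 1) (X : Matrix n n ℂ) :
    ntr (Q * X * Q') = ntr X := by
  rw [ntr, ntr, Matrix.mul_assoc, Matrix.trace_mul_comm, Matrix.mul_assoc, h2, Matrix.mul_one]

/-- `tr ((QAQ′)²) = tr (A²)` for `Q′Q = 1`. [folklore] -/
private lemma ntr_conj_sq {Q Q' : Matrix n n ℂ} (h2 : Q' * Q = 1) (A : Matrix n n ℂ) :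
    ntr (Q * A * Q' * (Q * A * Q')) = ntr (A * A) := by
  have h : Q * A * Q' * (Q * A * Q') = Q * (A * A) * Q' := by
    calc Q * A * Q' * (Q * A * Q') = Q * A * (Q' * Q) * A * Q' := by noncomm_ring
      _ = Q * (A * A) * Q' := by rw [h2]; noncomm_ring
  rw [h, ntr_conj h2]

/-- The holomorphic gauge-fixing density is a class function: `gHol(QUQ′) = gHol(U)` for `QQ′ = Q′Q = 1` (no
unitarity: `(QUQ′)⁻¹ = QU⁻¹Q′` and the trace is cyclic). [cite: Balaban1987RG1, (2.5) p.266] -/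
theorem gHol_conj {Q Q' : Matrix n n ℂ} (h1 : Q * Q' = 1) (h2 : Q' * Q = 1) (U : Matrix n n ℂ) :
    gHol (Q * U * Q') = gHol U := by
  have hQ' : Q' = Q⁻¹ := (Matrix.inv_eq_right_inv h1).symm
  have hQ : Q = Q'⁻¹ := (Matrix.inv_eq_right_inv h2).symm
  have hinv : (Q * U * Q')⁻¹ = Q * U⁻¹ * Q' := by
    rw [Matrix.mul_inv_rev, Matrix.mul_inv_rev, ← hQ, ← hQ', Matrix.mul_assoc]
  rw [gHol, gHol, hinv, ← ntr_conj h2 (U + U⁻¹), mul_add, add_mul]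

/-- ONE GERM, holomorphic reading: if `W′(Rx) = Q W(x) Q′` with `QQ′ = Q′Q = 1` and `R` a complex continuous linear
equivalence, the holomorphic third-order remainders agree, `g₃[W′](Rx) = g₃[W](x)`. [cite: Balaban1987RG1, (2.5) p.266] -/
theorem rem3C_conj {𝒴 : Type*} [NormedAddCommGroup 𝒴] [NormedSpace ℂ 𝒴] {W W' : 𝒴 → Matrix n n ℂ}
    {Q Q' : Matrix n n ℂ} (h1 : Q * Q' = 1) (h2 : Q' * Q = 1) (R : 𝒴 ≃L[ℂ] 𝒴)
    (hW : ∀ x, W' (R x) = Q * W x * Q') (x : 𝒴) :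
    rem3C W' (R x) = rem3C W x := by
  set Φ := conjCLEC Q Q' h1 h2 with hΦ
  have hfun : W' = Φ ∘ (W ∘ R.symm) := by
    funext C
    have h := hW (R.symm C)
    rw [R.apply_symm_apply] at h
    simp only [Function.comp_apply, hΦ, conjCLEC_apply, h]
  have hD : fderiv ℂ W' 0 (R x) = Q * fderiv ℂ W 0 x * Q' := by
    rw [hfun, Φ.comp_fderiv, R.symm.comp_right_fderiv, map_zero]
    simp only [ContinuousLinearMap.coe_comp, Function.comp_apply, ContinuousLinearEquiv.coe_coe,
      ContinuousLinearEquiv.symm_apply_apply, hΦ, conjCLEC_apply]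
  rw [rem3C, rem3C, hD, hW, gHol_conj h1 h2, ntr_conj_sq h2]

variable {P : Params} {k : ℕ} {G : Type*} [GaugeGroup G]
variable {𝒴 : Type*} [NormedAddCommGroup 𝒴] [NormedSpace ℂ 𝒴]

omit [NormedAddCommGroup 𝒴] [NormedSpace ℂ 𝒴] in
/-- **(2.16) on `GC`** (print's `G(Ṽ′) = G(B′)` in the holomorphic reading): invariant under `V⁽ᵏ⁾ → (V⁽ᵏ⁾)^u`,
`B′ → R(u)B′` for ANY matrix realisation `ρ` of the group and any map `R` — `gHol` is a class function.  Covers the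
`Gᶜ`-valued gauge transformations of (1.19) p. 263 when `G` is the complexified group. [cite: Balaban1987RG1, (2.16) p.269] -/
theorem GC_gaugeAct (ρ : G →* Matrix n n ℂ) (cd : ContourData P k G) (u : GaugeTransf P k G)
    (Vk : GaugeField P k G) {pert pert' : 𝒴 → GaugeField P k G} {R : 𝒴 → 𝒴}
    (hR : ∀ B', pert' (R B') = GaugeField.gaugeAct u (pert B')) (Y : Finset (Site P (k+1))) (B' : 𝒴) :
    GC ρ cd (GaugeField.gaugeAct u Vk) pert' Y (R B') = GC ρ cd Vk pert Y B' := by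
  unfold GC
  refine Finset.sum_congr rfl fun y _ => Finset.sum_congr rfl fun x _ => ?_
  rw [tildeV_gaugeAct cd u Vk hR B' y x, map_mul, map_mul,
    gHol_conj (rho_mul_rho_inv ρ _) (rho_inv_mul_rho ρ _)]

/-- **(2.16) on `G2C`** (the quadratic part, holomorphic reading `Σ −tr (B̃′(y, x)B′)²`): invariant for ANY matrix
realisation `ρ` and a complex continuous linear equivalence `R`. [cite: Balaban1987RG1, (2.16) p.269] -/
theorem G2C_gaugeAct (ρ : G →* Matrix n n ℂ) (cd : ContourData P k G) (u : GaugeTransf P k G)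
    (Vk : GaugeField P k G) {pert pert' : 𝒴 → GaugeField P k G} (R : 𝒴 ≃L[ℂ] 𝒴)
    (hR : ∀ B', pert' (R B') = GaugeField.gaugeAct u (pert B')) (Y : Finset (Site P (k+1))) (B' : 𝒴) :
    G2C ρ cd (GaugeField.gaugeAct u Vk) pert' Y (R B') = G2C ρ cd Vk pert Y B' := by
  unfold G2C
  refine Finset.sum_congr rfl fun y _ => Finset.sum_congr rfl fun x _ => ?_
  set Q := ρ (u (emb y))
  set Q' := ρ (u (emb y))⁻¹
  have h1 : Q * Q' = 1 := rho_mul_rho_inv ρ _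
  have h2 : Q' * Q = 1 := rho_inv_mul_rho ρ _
  set W : 𝒴 → Matrix n n ℂ := fun B'' => ρ (tildeV cd Vk pert B'' y x) with hWdef
  set W' : 𝒴 → Matrix n n ℂ := fun B'' => ρ (tildeV cd (GaugeField.gaugeAct u Vk) pert' B'' y x) with hW'def
  have hW : ∀ C, W' (R C) = Q * W C * Q' := fun C => by
    simp only [hWdef, hW'def, tildeV_gaugeAct cd u Vk hR C y x, map_mul, Q, Q']
  set Φ := conjCLEC Q Q' h1 h2 with hΦ
  have hfun : W' = Φ ∘ (W ∘ R.symm) := by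
    funext C
    have h := hW (R.symm C)
    rw [R.apply_symm_apply] at h
    simp only [Function.comp_apply, hΦ, conjCLEC_apply, h]
  have hD : fderiv ℂ W' 0 (R B') = Q * fderiv ℂ W 0 B' * Q' := by
    rw [hfun, Φ.comp_fderiv, R.symm.comp_right_fderiv, map_zero]
    simp only [ContinuousLinearMap.coe_comp, Function.comp_apply, ContinuousLinearEquiv.coe_coe,
      ContinuousLinearEquiv.symm_apply_apply, hΦ, conjCLEC_apply]
  rw [hD, ntr_conj_sq h2]

/-- **(2.16) on the block term `G3Cblock`** (holomorphic reading): invariant for ANY matrix realisation `ρ` and a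
complex continuous linear equivalence `R`. [cite: Balaban1987RG1, (2.16) p.269] -/
theorem G3Cblock_gaugeAct (ρ : G →* Matrix n n ℂ) (cd : ContourData P k G) (u : GaugeTransf P k G)
    (Vk : GaugeField P k G) {pert pert' : 𝒴 → GaugeField P k G} (R : 𝒴 ≃L[ℂ] 𝒴)
    (hR : ∀ B', pert' (R B') = GaugeField.gaugeAct u (pert B')) (y : Site P (k+1)) (B' : 𝒴) :
    G3Cblock ρ cd (GaugeField.gaugeAct u Vk) pert' y (R B') = G3Cblock ρ cd Vk pert y B' := by
  unfold G3Cblock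
  refine Finset.sum_congr rfl fun x _ => ?_
  refine rem3C_conj (rho_mul_rho_inv ρ (u (emb y))) (rho_inv_mul_rho ρ (u (emb y))) R (fun C => ?_) B'
  rw [tildeV_gaugeAct cd u Vk hR C y x, map_mul, map_mul]

/-- **(2.16) on `G3C`** (the third-order part, holomorphic reading): invariant for ANY matrix realisation `ρ` and a
complex continuous linear equivalence `R`. [cite: Balaban1987RG1, (2.16) p.269] -/
theorem G3C_gaugeAct (ρ : G →* Matrix n n ℂ) (cd : ContourData P k G) (u : GaugeTransf P k G)
    (Vk : GaugeField P k G) {pert pert' : 𝒴 → GaugeField P k G} (R : 𝒴 ≃L[ℂ] 𝒴)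
    (hR : ∀ B', pert' (R B') = GaugeField.gaugeAct u (pert B')) (Y : Finset (Site P (k+1))) (B' : 𝒴) :
    G3C ρ cd (GaugeField.gaugeAct u Vk) pert' Y (R B') = G3C ρ cd Vk pert Y B' := by
  unfold G3C
  exact Finset.sum_congr rfl fun y _ => G3Cblock_gaugeAct ρ cd u Vk R hR y B'

end Holo

/-! ## 6. Print's carrier: `B′` a `𝔤`-valued bond function on `T⁽ᵏ⁾`, `V′V⁽ᵏ⁾` bondwise, `R(u)` = `rotFluct` -/

section Carrier

variable {P : Params} {k : ℕ} {G : Type*} [GaugeGroup G] {𝔤 : Type*}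

/-- p. 265 *«V = V′V⁽ᵏ⁾»* bondwise, with `V′(b) = φ(B′(b))` for a chart `φ : 𝔤 → G` (print: `V′ = exp iB′`,
`B′ = (1/i) log V′`): the perturbation map `B′ ↦ V′V⁽ᵏ⁾` on print's carrier (`𝔤`-valued functions on the bonds of
`T⁽ᵏ⁾`).  The `ℤᵈ` twin is `B12AverageCorridor267.pert`. [cite: Balaban1987RG1, p.265] -/
def pertOf (φ : 𝔤 → G) (Vk : GaugeField P k G) (B' : VecField P k 𝔤) : GaugeField P k G :=
  fun b => φ (B' b) * Vk b

/-- Unfolding of `pertOf`. [cite: Balaban1987RG1, p.265] -/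
theorem pertOf_apply (φ : 𝔤 → G) (Vk : GaugeField P k G) (B' : VecField P k 𝔤) (b : PBond P k) :
    pertOf φ Vk B' b = φ (B' b) * Vk b := rfl

/-- `V′V⁽ᵏ⁾ = V⁽ᵏ⁾` at `B′ = 0` when `φ(0) = 1` (the hypothesis `pert 0 = V⁽ᵏ⁾` of the (2.5) files).
[cite: Balaban1987RG1, p.265] -/
theorem pertOf_zero [Zero 𝔤] {φ : 𝔤 → G} (hφ : φ 0 = 1) (Vk : GaugeField P k G) :
    pertOf φ Vk (0 : VecField P k 𝔤) = Vk := by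
  funext b
  rw [pertOf_apply, Pi.zero_apply, hφ, one_mul]

/-- **p. 265 «A gauge transformation v of V induces the gauge transformation v of V⁽ᵏ⁾ and the transformation
B′ → R(v)B′»** ON PRINT'S CARRIER — the hypothesis `hR` of §§ 1–5 DISCHARGED: for an `Ad`-equivariant chart
(`φ(R(g)X) = gφ(X)g⁻¹`, e.g. `exp i·`), transforming `V⁽ᵏ⁾ ↦ (V⁽ᵏ⁾)^u` and `B′ ↦ R(u)B′` ((2.16): `(R(u)B′)(b) =
R(u(b₋))B′(b)`, the tree's `rotFluct`) IS transforming `V′V⁽ᵏ⁾ ↦ (V′V⁽ᵏ⁾)^u`. [cite: Balaban1987RG1, (2.16) p.269] -/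
theorem pertOf_rotFluct {R : G → 𝔤 → 𝔤} {φ : 𝔤 → G} (hφ : ∀ g X, φ (R g X) = g * φ X * g⁻¹)
    (u : GaugeTransf P k G) (Vk : GaugeField P k G) (B' : VecField P k 𝔤) :
    pertOf φ (GaugeField.gaugeAct u Vk) (B12ChiInvariance269.rotFluct R u B')
      = GaugeField.gaugeAct u (pertOf φ Vk B') := by
  funext b
  simp only [pertOf_apply, B12ChiInvariance269.rotFluct, GaugeField.gaugeAct, hφ]
  group

variable [NormedAddCommGroup 𝔤] [NormedSpace ℝ 𝔤]

/-- (2.16) `B′ → R(u)B′` as a real continuous linear EQUIVALENCE of print's carrier, for a family of continuous linear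
equivalences `R(g)` of `𝔤` (e.g. the unitary adjoint action): bondwise `R(u(b₋))`. [cite: Balaban1987RG1, (2.16) p.269] -/
def rotFluctL (R : G → (𝔤 ≃L[ℝ] 𝔤)) (u : GaugeTransf P k G) : VecField P k 𝔤 ≃L[ℝ] VecField P k 𝔤 :=
  ContinuousLinearEquiv.piCongrRight fun b : PBond P k => R (u b.src)

omit [GaugeGroup G] in
/-- `rotFluctL` IS `rotFluct`. [cite: Balaban1987RG1, (2.16) p.269] -/
theorem rotFluctL_apply (R : G → (𝔤 ≃L[ℝ] 𝔤)) (u : GaugeTransf P k G) (B' : VecField P k 𝔤) :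
    rotFluctL R u B' = B12ChiInvariance269.rotFluct (fun g X => R g X) u B' := rfl

omit [NormedAddCommGroup 𝔤] [NormedSpace ℝ 𝔤] in
/-- **(2.16) FOR `G(Ṽ′)` ON PRINT'S CARRIER**: `G(Ṽ′)((V⁽ᵏ⁾)^u, R(u)B′) = G(Ṽ′)(V⁽ᵏ⁾, B′)` for the bondwise
perturbation `V′V⁽ᵏ⁾ = φ(B′)V⁽ᵏ⁾` with an `Ad`-equivariant chart `φ`. [cite: Balaban1987RG1, (2.16) p.269] -/
theorem Gtilde_rotFluct (cd : ContourData P k G) {R : G → 𝔤 → 𝔤} {φ : 𝔤 → G}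
    (hφ : ∀ g X, φ (R g X) = g * φ X * g⁻¹) (u : GaugeTransf P k G) (Vk : GaugeField P k G)
    (Y : Finset (Site P (k+1))) (B' : VecField P k 𝔤) :
    Gtilde cd (GaugeField.gaugeAct u Vk) (pertOf φ (GaugeField.gaugeAct u Vk)) Y
        (B12ChiInvariance269.rotFluct R u B')
      = Gtilde cd Vk (pertOf φ Vk) Y B' :=
  Gtilde_gaugeAct cd u Vk (R := B12ChiInvariance269.rotFluct R u) (fun C => pertOf_rotFluct hφ u Vk C) Y B'

variable {n : Type*} [Fintype n] [DecidableEq n]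

attribute [local instance 10000] B12GaugeFixExpansion25.instModuleRealMatrixComplex
  B12GaugeFixExpansion25.instNormedSpaceRealMatrixComplex

/-- **(2.16) FOR `G⁽²⁾` ON PRINT'S CARRIER** (unitary realisation `ρ`, `R(g)` continuous linear equivalences of `𝔤`,
`Ad`-equivariant chart `φ`). [cite: Balaban1987RG1, (2.16) p.269] -/
theorem G2_rotFluct {ρ : G →* Matrix n n ℂ} (hρU : ∀ g : G, ρ g ∈ Matrix.unitaryGroup n ℂ)
    (cd : ContourData P k G) {R : G → (𝔤 ≃L[ℝ] 𝔤)} {φ : 𝔤 → G} (hφ : ∀ g X, φ (R g X) = g * φ X * g⁻¹)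
    (u : GaugeTransf P k G) (Vk : GaugeField P k G) (Y : Finset (Site P (k+1))) (B' : VecField P k 𝔤) :
    G2 ρ cd (GaugeField.gaugeAct u Vk) (pertOf φ (GaugeField.gaugeAct u Vk)) Y (rotFluctL R u B')
      = G2 ρ cd Vk (pertOf φ Vk) Y B' :=
  G2_gaugeAct hρU cd u Vk (rotFluctL R u) (fun C => pertOf_rotFluct hφ u Vk C) Y B'

/-- **(2.16) FOR `G₃` ON PRINT'S CARRIER** (unitary realisation `ρ`, `R(g)` continuous linear equivalences of `𝔤`,
`Ad`-equivariant chart `φ`). [cite: Balaban1987RG1, (2.16) p.269] -/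
theorem G3_rotFluct {ρ : G →* Matrix n n ℂ} (hρU : ∀ g : G, ρ g ∈ Matrix.unitaryGroup n ℂ)
    (cd : ContourData P k G) {R : G → (𝔤 ≃L[ℝ] 𝔤)} {φ : 𝔤 → G} (hφ : ∀ g X, φ (R g X) = g * φ X * g⁻¹)
    (u : GaugeTransf P k G) (Vk : GaugeField P k G) (Y : Finset (Site P (k+1))) (B' : VecField P k 𝔤) :
    G3 ρ cd (GaugeField.gaugeAct u Vk) (pertOf φ (GaugeField.gaugeAct u Vk)) Y (rotFluctL R u B')
      = G3 ρ cd Vk (pertOf φ Vk) Y B' :=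
  G3_gaugeAct hρU cd u Vk (rotFluctL R u) (fun C => pertOf_rotFluct hφ u Vk C) Y B'

end Carrier

end

end Literature.MathematicalPhysics.QuantumFieldTheory.Balaban1983to89.B12Eq25GaugeInvariance216
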